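import Literature.NumberTheory.LFunctions.WeilSemilocalQuadratic
import Literature.NumberTheory.LFunctions.UniformWeilPositivityRH
import Mathlib.NumberTheory.Bertrand
import HarnessLib

/-!
# The handoff decomposition of Weil positivity along the primes: exact logical status

Track «HANDOFF» of the rh-explicit cell (seat handoff-prove-1, ATTEMPT-1).  For a prime `q` with next prime `q⁺` and
`S_q = {p prime : p < q}` (`primesBelow q`), on the window `C((log q⁺)/2)` of test functions supported in
`[−(log q⁺)/2, (log q⁺)/2]` Weil's quadratic form differs from the semi-local form at the places `S_q ∪ {∞}` by the
single atom `q`: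

`Q(g) = Q_{S_q}(g) − (log q/√q)·(k(log q) + k(−log q))`, `k = g ⋆ g̃`

(`weilQuadratic_eq_weilSemilocalQuadratic_sub_atom`; the prime powers `q^m`, `m ≥ 2`, and all larger primes are
invisible below `q⁺ ≤ 2q` — Bertrand).  Two consequences, both PROVED here with no named facts:

* the «handoff step» `HandoffStep q q⁺ : WeilPositivityOn (log q/2) → WeilPositivityOn (log q⁺/2)` decomposes the
  Riemann hypothesis along consecutive primes: `RiemannHypothesis ↔ ∀ consecutive primes q < q⁺, HandoffStep q q⁺`
  (`riemannHypothesis_iff_forall_handoffStep`; the base `WeilPositivityOn (log 2/2)` is the tree's theorem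
  `weilPositivityOn_of_le_log_two_half`, the criterion is `riemannHypothesis_iff_forall_weilPositivityOn`);
* the NORM-LEVEL NECESSARY CONDITION `HandoffNecessary q q⁺`: `Re Q_{S_q}(g) ≥ −(2 log q/√q)‖g‖₂²` on `C((log q⁺)/2)`
  — a statement about an RH-free object (finitely many places) with an explicit tolerance — satisfies
  `RiemannHypothesis ↔ ∀ consecutive primes q < q⁺, HandoffNecessary q q⁺`
  (`riemannHypothesis_iff_forall_handoffNecessary`): `→` by the identity and `|k(x)| ≤ ‖g‖₂²`; `←` because
  `Q_{S_q} = Q` on `C((log q)/2)` and `(log q)/√q → 0`, so the necessary conditions along any infinite set of primes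
  force `WeilPositivityOn a` for every `a`.

Honest reading: the equivalences are elementary bookkeeping on top of Weil's criterion; they locate WHERE a proof of RH by
support extension must work (the step from `(log q)/2` to `(log q⁺)/2`, uniformly in `q`) and show that even the crude
necessary inequality, uniformly in `q`, is already RH.  Nothing here is evidence for RH.  The sharper edge-layer constant
`(log q)/√q` of the seat's ATTEMPT-1 §2 is not formalised (the factor 2 is immaterial to the logical status).
-/

noncomputable section

set_option linter.dupNamespace false  -- the mandated namespace repeats `RiemannHypothesis`

open Complex Filter Set MeasureTheory
open scoped Real Topology ComplexConjugate

namespace Summit.RiemannHypothesis.RiemannHypothesis.Theorems.SemilocalHandoff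

open Literature.NumberTheory.LFunctions

variable {g : ℝ → ℂ} {q q' : ℕ}

/-! ## Consecutive primes and the prime set below `q` -/

/-- The finite set of primes `< q` (the places `S_q` of the handoff decomposition). [folklore] -/
def primesBelow (q : ℕ) : Finset ℕ := (Finset.range q).filter Nat.Prime

/-- `NextPrime q q'`: `q < q'` are CONSECUTIVE primes (`q'` is the least prime above the prime `q`). [folklore] -/
def NextPrime (q q' : ℕ) : Prop := q.Prime ∧ q'.Prime ∧ q < q' ∧ ∀ p : ℕ, p.Prime → q < p → q' ≤ p

/-- Membership in `primesBelow q`. -/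
theorem mem_primesBelow {p q : ℕ} : p ∈ primesBelow q ↔ p < q ∧ p.Prime := by
  simp [primesBelow]

/-- Every prime has a next prime. -/
theorem exists_nextPrime (hq : q.Prime) : ∃ q', NextPrime q q' := by
  classical
  have h : ∃ m, q < m ∧ m.Prime := by
    obtain ⟨p, hp, hpp⟩ := Nat.exists_infinite_primes (q + 1)
    exact ⟨p, hp, hpp⟩
  refine ⟨Nat.find h, hq, (Nat.find_spec h).2, (Nat.find_spec h).1, fun p hp hqp ↦ ?_⟩
  exact Nat.find_min' h ⟨hqp, hp⟩

/-- Bertrand: the next prime is at most `2q`. -/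
theorem NextPrime.le_two_mul (h : NextPrime q q') : q' ≤ 2 * q := by
  obtain ⟨p, hp, hqp, hp2⟩ := Nat.exists_prime_lt_and_le_two_mul q h.1.ne_zero
  exact (h.2.2.2 p hp hqp).trans hp2

/-- On the window of `q` the only prime power `< q'` whose prime is not below `q` is `q` itself: a sum over the
non-`S_q`-smooth `n < q'` weighted by `Λ(n)` collapses to the `n = q` term. -/
theorem sum_filter_not_subset_primesBelow (h : NextPrime q q') (X : ℕ → ℂ) :
    ∑ n ∈ (Finset.range q').filter (fun n ↦ ¬ n.primeFactors ⊆ primesBelow q),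
        ((ArithmeticFunction.vonMangoldt n : ℝ) : ℂ) / (Real.sqrt n : ℂ) * X n =
      ((Real.log q : ℝ) : ℂ) / (Real.sqrt q : ℂ) * X q := by
  have hq := h.1
  have hmem : q ∈ (Finset.range q').filter (fun n ↦ ¬ n.primeFactors ⊆ primesBelow q) := by
    rw [Finset.mem_filter, Finset.mem_range, hq.primeFactors, Finset.singleton_subset_iff, mem_primesBelow]
    exact ⟨h.2.2.1, fun hh ↦ lt_irrefl q hh.1⟩
  rw [Finset.sum_eq_single_of_mem q hmem]
  · rw [ArithmeticFunction.vonMangoldt_apply_prime hq]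
  intro n hn hne
  rw [Finset.mem_filter, Finset.mem_range] at hn
  suffices hΛ : ArithmeticFunction.vonMangoldt n = 0 by simp [hΛ]
  rw [ArithmeticFunction.vonMangoldt_eq_zero_iff]
  intro hpow
  obtain ⟨p, k, hp, hk, rfl⟩ := (isPrimePow_nat_iff _).1 hpow
  have hpf : (p ^ k).primeFactors = {p} := Nat.primeFactors_prime_pow hk.ne' hp
  have hpq : q ≤ p := by
    have hnot : ¬ p ∈ primesBelow q := by
      intro hmemp
      exact hn.2 (by rw [hpf, Finset.singleton_subset_iff]; exact hmemp)
    rw [mem_primesBelow] at hnot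
    by_contra hlt
    exact hnot ⟨lt_of_not_ge hlt, hp⟩
  rcases Nat.lt_or_ge k 2 with hk1 | hk2
  · -- k = 1 : n = p is a prime in [q, q'), hence p = q
    have hk1' : k = 1 := by omega
    subst hk1'
    rw [pow_one] at hn hne
    rcases hpq.lt_or_eq with hlt | heq
    · exact absurd hn.1 (not_lt.2 (h.2.2.2 p hp hlt))
    · exact hne heq.symm
  · -- k ≥ 2 : p^k ≥ q² ≥ 2q ≥ q' — invisible on the window
    have h2q : q' ≤ 2 * q := h.le_two_mul
    have hq2 : 2 ≤ q := hq.two_le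
    have hpk : q * q ≤ p ^ k :=
      (Nat.mul_le_mul hpq hpq).trans (by simpa [pow_two] using Nat.pow_le_pow_right hp.pos hk2)
    have : p ^ k < q' := hn.1
    nlinarith

/-! ## The window identity -/

/-- **`Q − Q_S` on the window `C((log (N+1))/2)`**: for `tsupport g ⊆ [−(log (N+1))/2, (log (N+1))/2]` the full form
differs from the semi-local form at `S ∪ {∞}` exactly by the atoms `n ≤ N` that are NOT `S`-smooth:
`Q(g) − Q_S(g) = −Σ_{n ≤ N, primeFactors n ⊄ S} (Λ(n)/√n)(k(log n) + k(−log n))`, `k = g ⋆ g̃`. -/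
theorem weilQuadratic_sub_weilSemilocalQuadratic (hg : IsWeilTest g) (S : Finset ℕ) (N : ℕ)
    (hsupp : tsupport g ⊆ Icc (-(Real.log ((N : ℝ) + 1) / 2)) (Real.log ((N : ℝ) + 1) / 2)) :
    weilQuadratic g - weilSemilocalQuadratic S g =
      -∑ n ∈ (Finset.range (N + 1)).filter (fun n ↦ ¬ n.primeFactors ⊆ S),
        ((ArithmeticFunction.vonMangoldt n : ℝ) : ℂ) / (Real.sqrt n : ℂ) *
          (weilConv g (weilReflect g) (Real.log n) + weilConv g (weilReflect g) (-Real.log n)) := by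
  have hk : IsWeilTest (weilConv g (weilReflect g)) := hg.weilConv hg.weilReflect
  have hks : tsupport (weilConv g (weilReflect g)) ⊆ Icc (-Real.log ((N : ℝ) + 1)) (Real.log ((N : ℝ) + 1)) := by
    have h := tsupport_weilConv_weilReflect_subset (a := Real.log ((N : ℝ) + 1) / 2) hg.2 hsupp
    rwa [show 2 * (Real.log ((N : ℝ) + 1) / 2) = Real.log ((N : ℝ) + 1) by ring] at h
  have e1 : weilQuadratic g - weilSemilocalQuadratic S g =
      weilSemilocalPrimeTerm S (weilConv g (weilReflect g)) - weilPrimeTerm (weilConv g (weilReflect g)) := by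
    unfold weilQuadratic weilSemilocalQuadratic weilFunctional weilSemilocalFunctional
    ring
  rw [e1, weilPrimeTerm_eq_sum_of_tsupport_subset hk.1.continuous N hks,
    weilSemilocalPrimeTerm_eq_sum_of_tsupport_subset S hk.1.continuous N hks, ← Finset.sum_sub_distrib,
    Finset.sum_filter, ← Finset.sum_neg_distrib]
  refine Finset.sum_congr rfl fun n _ ↦ ?_
  unfold weilSemilocalCoeff
  by_cases hS : n.primeFactors ⊆ S
  · simp only [hS, not_true_eq_false, if_true, if_false, neg_zero]
    push_cast
    ring
  · simp only [hS, not_false_eq_true, if_true, if_false]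
    push_cast
    ring

/-- **The single missing atom on the window of `q`**: for consecutive primes `q < q'` and
`tsupport g ⊆ [−(log q')/2, (log q')/2]`,
`Q(g) = Q_{S_q}(g) − (log q/√q)·(k(log q) + k(−log q))` with `S_q = primesBelow q`, `k = g ⋆ g̃`. -/
theorem weilQuadratic_eq_weilSemilocalQuadratic_sub_atom (h : NextPrime q q') (hg : IsWeilTest g)
    (hsupp : tsupport g ⊆ Icc (-(Real.log q' / 2)) (Real.log q' / 2)) :
    weilQuadratic g = weilSemilocalQuadratic (primesBelow q) g -
      ((Real.log q : ℝ) : ℂ) / (Real.sqrt q : ℂ) *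
        (weilConv g (weilReflect g) (Real.log q) + weilConv g (weilReflect g) (-Real.log q)) := by
  have hq'1 : 1 ≤ q' := h.2.1.one_lt.le
  have hcast : ((q' - 1 : ℕ) : ℝ) + 1 = (q' : ℝ) := by
    rw [Nat.cast_sub hq'1]; push_cast; ring
  have hsupp' : tsupport g ⊆ Icc (-(Real.log (((q' - 1 : ℕ) : ℝ) + 1) / 2)) (Real.log (((q' - 1 : ℕ) : ℝ) + 1) / 2) := by
    rwa [hcast]
  have hsub := weilQuadratic_sub_weilSemilocalQuadratic hg (primesBelow q) (q' - 1) hsupp'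
  rw [Nat.sub_add_cancel hq'1, sum_filter_not_subset_primesBelow h] at hsub
  linear_combination hsub

/-- Below its own atom the semi-local form at `S_q ∪ {∞}` IS Weil's form: `Q_{S_q}(g) = Q(g)` for
`tsupport g ⊆ [−(log q)/2, (log q)/2]` (`q ≥ 1`). -/
theorem weilSemilocalQuadratic_primesBelow_eq (hq : 1 ≤ q) (hg : IsWeilTest g)
    (hsupp : tsupport g ⊆ Icc (-(Real.log q / 2)) (Real.log q / 2)) :
    weilSemilocalQuadratic (primesBelow q) g = weilQuadratic g := by
  have hcast : ((q - 1 : ℕ) : ℝ) + 1 = (q : ℝ) := by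
    rw [Nat.cast_sub hq]; push_cast; ring
  have hsupp' : tsupport g ⊆ Icc (-(Real.log (((q - 1 : ℕ) : ℝ) + 1) / 2)) (Real.log (((q - 1 : ℕ) : ℝ) + 1) / 2) := by
    rwa [hcast]
  refine weilSemilocalQuadratic_eq_weilQuadratic_of_forall hg (fun n hn hpow ↦ ?_) hsupp'
  obtain ⟨p, k, hp, hk, rfl⟩ := (isPrimePow_nat_iff _).1 hpow
  rw [Nat.primeFactors_prime_pow hk.ne' hp, Finset.singleton_subset_iff, mem_primesBelow]
  refine ⟨?_, hp⟩
  have hppk : p ≤ p ^ k := Nat.le_self_pow hk.ne' p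
  omega

/-! ## The crude bound `|k(x)| ≤ ‖g‖₂²` -/

/-- `|(g ⋆ g̃)(x)| ≤ ‖g‖₂²` for every `x` (Cauchy–Schwarz in the AM–GM form `2|ab| ≤ |a|² + |b|²` and translation
invariance of Lebesgue measure). -/
theorem norm_weilConv_weilReflect_le (hg : IsWeilTest g) (x : ℝ) :
    ‖weilConv g (weilReflect g) x‖ ≤ weilNorm2Sq g := by
  rw [weilConv_apply]
  have hcont : Continuous g := hg.1.continuous
  have hsq : Integrable fun u : ℝ ↦ ‖g u‖ ^ 2 := by
    have hc : Continuous fun u : ℝ ↦ ‖g u‖ ^ 2 := by fun_prop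
    refine hc.integrable_of_hasCompactSupport ?_
    simpa [Function.comp_def] using hg.2.comp_left (g := fun z : ℂ ↦ ‖z‖ ^ 2) (by simp)
  have hsq' : Integrable fun u : ℝ ↦ ‖g (u - x)‖ ^ 2 := hsq.comp_sub_right x
  have hpt : ∀ u : ℝ, ‖g u * weilReflect g (x - u)‖ ≤ (‖g u‖ ^ 2 + ‖g (u - x)‖ ^ 2) / 2 := by
    intro u
    rw [norm_mul]
    unfold weilReflect
    rw [Complex.norm_conj, show -(x - u) = u - x by ring]
    nlinarith [sq_nonneg (‖g u‖ - ‖g (u - x)‖), norm_nonneg (g u), norm_nonneg (g (u - x))]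
  calc ‖∫ u, g u * weilReflect g (x - u)‖
      ≤ ∫ u, ‖g u * weilReflect g (x - u)‖ := norm_integral_le_integral_norm _
    _ ≤ ∫ u, (‖g u‖ ^ 2 + ‖g (u - x)‖ ^ 2) / 2 := by
        refine integral_mono_of_nonneg (Eventually.of_forall fun u ↦ norm_nonneg _)
          ((hsq.add hsq').div_const 2) (Eventually.of_forall hpt)
    _ = ((∫ u, ‖g u‖ ^ 2) + ∫ u, ‖g (u - x)‖ ^ 2) / 2 := by
        rw [integral_div, integral_add hsq hsq']
    _ = weilNorm2Sq g := by
        rw [integral_sub_right_eq_self (fun u : ℝ ↦ ‖g u‖ ^ 2) x]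
        unfold weilNorm2Sq
        ring

/-! ## The handoff step and the norm-level necessary condition -/

/-- **The handoff step at the prime `q`**: Weil positivity up to the entry of `q` (window `(log q)/2`) implies Weil
positivity up to the entry of the next prime `q'` (window `(log q')/2`).  A DEFINITION (an implication between two
window statements), used as the unit of the decomposition `riemannHypothesis_iff_forall_handoffStep`. [folklore] -/
def HandoffStep (q q' : ℕ) : Prop :=
  WeilPositivityOn (Real.log q / 2) → WeilPositivityOn (Real.log q' / 2)

/-- **The norm-level necessary condition `N(q)`** (crude constant `2 log q/√q`): on the window of `q` the semi-local
form at `S_q ∪ {∞}` — an object with finitely many places — is bounded below by `−(2 log q/√q)‖g‖₂²`.  A DEFINITION;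
its status is `riemannHypothesis_iff_forall_handoffNecessary`. [folklore] -/
def HandoffNecessary (q q' : ℕ) : Prop :=
  ∀ g : ℝ → ℂ, IsWeilTest g → tsupport g ⊆ Icc (-(Real.log q' / 2)) (Real.log q' / 2) →
    -(2 * Real.log q / Real.sqrt q) * weilNorm2Sq g ≤ (weilSemilocalQuadratic (primesBelow q) g).re

/-- Weil positivity on the window of `q` implies `N(q)`: `0 ≤ Re Q = Re Q_{S_q} − (log q/√q) Re(k(log q)+k(−log q))`
and `|k(±log q)| ≤ ‖g‖₂²`. -/
theorem handoffNecessary_of_weilPositivityOn (h : NextPrime q q') (hW : WeilPositivityOn (Real.log q' / 2)) :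
    HandoffNecessary q q' := by
  intro g hg hsupp
  have hpos := hW g hg hsupp
  rw [weilQuadratic_eq_weilSemilocalQuadratic_sub_atom h hg hsupp, Complex.sub_re] at hpos
  set K := weilConv g (weilReflect g) (Real.log q) + weilConv g (weilReflect g) (-Real.log q) with hK
  have hcoef : (((Real.log q : ℝ) : ℂ) / (Real.sqrt q : ℂ) * K).re = Real.log q / Real.sqrt q * K.re := by
    rw [show ((Real.log q : ℝ) : ℂ) / (Real.sqrt q : ℂ) = ((Real.log q / Real.sqrt q : ℝ) : ℂ) by push_cast; rfl,
      Complex.re_ofReal_mul]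
  rw [hcoef] at hpos
  have hKre : -(2 * weilNorm2Sq g) ≤ K.re := by
    have h1 := norm_weilConv_weilReflect_le hg (Real.log q)
    have h2 := norm_weilConv_weilReflect_le hg (-Real.log q)
    have hre : |K.re| ≤ ‖K‖ := Complex.abs_re_le_norm K
    have hn : ‖K‖ ≤ ‖weilConv g (weilReflect g) (Real.log q)‖ + ‖weilConv g (weilReflect g) (-Real.log q)‖ :=
      norm_add_le _ _
    have := (abs_le.1 (hre.trans hn)).1
    linarith
  have hc : 0 ≤ Real.log q / Real.sqrt q :=
    div_nonneg (Real.log_nonneg (by exact_mod_cast h.1.one_lt.le)) (Real.sqrt_nonneg _)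
  have hprod := mul_le_mul_of_nonneg_left hKre hc
  have e : -(2 * Real.log q / Real.sqrt q) * weilNorm2Sq g = Real.log q / Real.sqrt q * (-(2 * weilNorm2Sq g)) := by
    ring
  rw [e]
  linarith

/-- `RH ⟹ N(q)` for every pair of consecutive primes. -/
theorem handoffNecessary_of_riemannHypothesis (hRH : RiemannHypothesis) (h : NextPrime q q') :
    HandoffNecessary q q' :=
  handoffNecessary_of_weilPositivityOn h
    (riemannHypothesis_iff_forall_weilPositivityOn.1 hRH _
      (div_pos (Real.log_pos (by exact_mod_cast h.2.1.one_lt)) two_pos))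

/-- `log q ≤ 4 √√q` (crude: `log y ≤ y − 1` at `y = q^{1/4}`). -/
theorem log_le_four_mul_sqrt_sqrt {x : ℝ} (hx : 0 < x) : Real.log x ≤ 4 * Real.sqrt (Real.sqrt x) := by
  have hs : 0 < Real.sqrt (Real.sqrt x) := Real.sqrt_pos.2 (Real.sqrt_pos.2 hx)
  have hx4 : Real.sqrt (Real.sqrt x) ^ 4 = x := by
    rw [show (4 : ℕ) = 2 * 2 by norm_num, pow_mul, Real.sq_sqrt (Real.sqrt_nonneg _), Real.sq_sqrt hx.le]
  have hlog : Real.log x = 4 * Real.log (Real.sqrt (Real.sqrt x)) := by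
    conv_lhs => rw [← hx4]
    rw [Real.log_pow]
    push_cast
    ring
  rw [hlog]
  have := Real.log_le_sub_one_of_pos hs
  linarith

/-- **`N(q)` along the consecutive primes implies RH.**  If `Re Q(g₀) < 0` for some test function `g₀ ∈ C(a)`, pick a
prime `q` with `(log q)/2 ≥ a` and `(2 log q/√q)‖g₀‖₂² < −Re Q(g₀)`; on `C((log q)/2)` the semi-local form IS Weil's
form, so `N(q)` is violated by `g₀`. -/
theorem riemannHypothesis_of_forall_handoffNecessary (hN : ∀ q q' : ℕ, NextPrime q q' → HandoffNecessary q q') :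
    RiemannHypothesis := by
  rw [riemannHypothesis_iff_forall_weilPositivityOn]
  intro a ha g hg hsupp
  by_contra hneg
  push Not at hneg
  set c : ℝ := -(weilQuadratic g).re with hc
  have hcpos : 0 < c := by linarith
  set W : ℝ := weilNorm2Sq g with hW
  have hW0 : 0 ≤ W := weilNorm2Sq_nonneg g
  -- a prime q beyond both thresholds
  set M : ℝ := max (Real.exp (2 * a)) ((8 * W / c + 1) ^ 4) with hM
  obtain ⟨q, hqM, hq⟩ := Nat.exists_infinite_primes (⌈M⌉₊ + 1)
  have hqM' : M ≤ q := by
    have h1 : (M : ℝ) ≤ ⌈M⌉₊ := Nat.le_ceil M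
    have h2 : ((⌈M⌉₊ + 1 : ℕ) : ℝ) ≤ q := by exact_mod_cast hqM
    push_cast at h2
    linarith
  have hqpos : (0 : ℝ) < q := by exact_mod_cast hq.pos
  -- (i) the window of q contains [−a, a]
  have ha_le : a ≤ Real.log q / 2 := by
    have hexp : Real.exp (2 * a) ≤ q := (le_max_left _ _).trans hqM'
    have := Real.log_le_log (Real.exp_pos _) hexp
    rw [Real.log_exp] at this
    linarith
  -- (ii) the tolerance is below c
  have htol : 2 * Real.log q / Real.sqrt q * W < c := by
    have hs : 0 < Real.sqrt (Real.sqrt (q : ℝ)) := Real.sqrt_pos.2 (Real.sqrt_pos.2 hqpos)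
    have hroot : 8 * W / c + 1 ≤ Real.sqrt (Real.sqrt (q : ℝ)) := by
      have hy : 0 ≤ 8 * W / c + 1 := by positivity
      have h4 : (8 * W / c + 1) ^ 4 ≤ q := (le_max_right _ _).trans hqM'
      have e : Real.sqrt (Real.sqrt ((8 * W / c + 1) ^ 4)) = 8 * W / c + 1 := by
        rw [show (8 * W / c + 1) ^ 4 = ((8 * W / c + 1) ^ 2) ^ 2 by ring, Real.sqrt_sq (by positivity),
          Real.sqrt_sq hy]
      rw [← e]
      exact Real.sqrt_le_sqrt (Real.sqrt_le_sqrt h4)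
    have hlog : Real.log q ≤ 4 * Real.sqrt (Real.sqrt (q : ℝ)) := log_le_four_mul_sqrt_sqrt hqpos
    have hss : Real.sqrt (Real.sqrt (q : ℝ)) * Real.sqrt (Real.sqrt (q : ℝ)) = Real.sqrt (q : ℝ) :=
      Real.mul_self_sqrt (Real.sqrt_nonneg _)
    have hsqpos : 0 < Real.sqrt (q : ℝ) := Real.sqrt_pos.2 hqpos
    -- 2 log q /√q * W ≤ 8 W / √√q < c
    have hstep : 2 * Real.log q / Real.sqrt q * W ≤ 8 * W / Real.sqrt (Real.sqrt (q : ℝ)) := by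
      rw [div_mul_eq_mul_div, div_le_div_iff₀ hsqpos hs]
      have h8 : 8 * W * Real.sqrt (q : ℝ) = 8 * W * Real.sqrt (Real.sqrt (q : ℝ)) * Real.sqrt (Real.sqrt (q : ℝ)) := by
        rw [mul_assoc (8 * W) (Real.sqrt (Real.sqrt (q : ℝ))) (Real.sqrt (Real.sqrt (q : ℝ))), hss]
      rw [h8]
      nlinarith [mul_nonneg (sub_nonneg.2 hlog) (mul_nonneg hW0 hs.le)]
    have hfin : 8 * W / Real.sqrt (Real.sqrt (q : ℝ)) < c := by
      rw [div_lt_iff₀ hs]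
      have : 8 * W < c * (8 * W / c + 1) := by
        rw [mul_add, mul_div_cancel₀ _ hcpos.ne', mul_one]
        linarith
      nlinarith
    linarith
  -- apply N(q) to g on the window of q
  obtain ⟨q', hqq'⟩ := exists_nextPrime hq
  have hsupp_q : tsupport g ⊆ Icc (-(Real.log q / 2)) (Real.log q / 2) :=
    hsupp.trans (Icc_subset_Icc (by linarith) ha_le)
  have hlogle : Real.log q / 2 ≤ Real.log q' / 2 := by
    have := Real.log_le_log hqpos (show (q : ℝ) ≤ q' by exact_mod_cast hqq'.2.2.1.le)
    linarith
  have hsupp_q' : tsupport g ⊆ Icc (-(Real.log q' / 2)) (Real.log q' / 2) :=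
    hsupp_q.trans (Icc_subset_Icc (by linarith) hlogle)
  have hNq := hN q q' hqq' g hg hsupp_q'
  rw [weilSemilocalQuadratic_primesBelow_eq hq.one_lt.le hg hsupp_q] at hNq
  -- −tol·W ≤ Re Q(g) = −c < −tol·W
  have : -(2 * Real.log q / Real.sqrt q) * W ≤ -c := by rw [hc]; simpa using hNq
  linarith

/-- **Exact logical status of the norm-level necessary condition**:
`RiemannHypothesis ↔ ∀ consecutive primes q < q', HandoffNecessary q q'`. -/
theorem riemannHypothesis_iff_forall_handoffNecessary :
    RiemannHypothesis ↔ ∀ q q' : ℕ, NextPrime q q' → HandoffNecessary q q' :=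
  ⟨fun hRH _ _ h ↦ handoffNecessary_of_riemannHypothesis hRH h, riemannHypothesis_of_forall_handoffNecessary⟩

/-- Induction along the primes: from the handoff steps, some prime `P ≥ n` has a Weil-positive window `(log P)/2`,
for every `n`. -/
theorem exists_prime_ge_weilPositivityOn (hH : ∀ q q' : ℕ, NextPrime q q' → HandoffStep q q') (n : ℕ) :
    ∃ P : ℕ, P.Prime ∧ n ≤ P ∧ WeilPositivityOn (Real.log P / 2) := by
  induction n with
  | zero => exact ⟨2, Nat.prime_two, Nat.zero_le _, by
      exact_mod_cast weilPositivityOn_of_le_log_two_half (a := Real.log (2 : ℕ) / 2) (by push_cast; exact le_rfl)⟩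
  | succ n ih =>
      obtain ⟨P, hP, hnP, hWP⟩ := ih
      rcases Nat.lt_or_ge n P with hlt | hge
      · exact ⟨P, hP, hlt, hWP⟩
      · obtain ⟨P', hPP'⟩ := exists_nextPrime hP
        exact ⟨P', hPP'.2.1, by have := hPP'.2.2.1; omega, hH P P' hPP' hWP⟩

/-- **Exact logical status of the handoff decomposition**: the Riemann hypothesis is equivalent to the conjunction of
the handoff steps over all pairs of consecutive primes (the base window `(log 2)/2` being a theorem of the tree). -/
theorem riemannHypothesis_iff_forall_handoffStep :
    RiemannHypothesis ↔ ∀ q q' : ℕ, NextPrime q q' → HandoffStep q q' := by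
  constructor
  · intro hRH q q' h _
    exact riemannHypothesis_iff_forall_weilPositivityOn.1 hRH _
      (div_pos (Real.log_pos (by exact_mod_cast h.2.1.one_lt)) two_pos)
  · intro hH
    rw [riemannHypothesis_iff_forall_weilPositivityOn]
    intro a ha
    obtain ⟨P, hP, hnP, hWP⟩ := exists_prime_ge_weilPositivityOn hH (⌈Real.exp (2 * a)⌉₊)
    refine hWP.mono ?_
    have hPpos : (0 : ℝ) < P := by exact_mod_cast hP.pos
    have hexp : Real.exp (2 * a) ≤ P := (Nat.le_ceil _).trans (by exact_mod_cast hnP)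
    have := Real.log_le_log (Real.exp_pos _) hexp
    rw [Real.log_exp] at this
    linarith

end Summit.RiemannHypothesis.RiemannHypothesis.Theorems.SemilocalHandoff

end
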